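import Summits.NavierStokesRegularity.NavierStokesRegularity.Theorems.ExtremiserTransienceNearExtremalTransienceExtremiserLiouvilleConstantSpeedBarycentreZero
import Summits.NavierStokesRegularity.NavierStokesRegularity.Theorems.ExtremiserTransienceNearExtremalTransienceExtremiserLiouvilleConstantSpeedBlowDownVorticity
import Summits.NavierStokesRegularity.NavierStokesRegularity.Theorems.ExtremiserTransienceNearExtremalTransienceExtremiserLiouvilleConstantSpeedMultiplierIdentities
import HarnessLib

/-!
# Crux `ExtremiserTransience.NearExtremalTransience` (stmt-NavierStokesRegularity-21883), line `extremiser_liouville`,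
# stub K1b — CONSEQUENCES OF THE ZERO BARYCENTRE FOR EVERY RESIDUE: exact multiplier mass, no point force, irrotational blow-downs

`--supports stmt-NavierStokesRegularity-21883` (helper).  Author: prover seat `ns-el-k1b` (g6).  With `∫ v dμ = 0` for EVERY
residue object (`…ConstantSpeedBarycentreZero`, axial frame, `v − c ∈ L⁶`) the laws proved by g3/g5/g6 for the multiplier `μ`
and the blow-downs take their final form, flat OR jet:

* `multiplier_inner_farField_eq_zero`, `multiplier_mass_eq` : `∫⟪v, c⟫dμ = 0` and **`μ(ℝ³) = S²/M² = κ⋆²ZW` exactly** (g3's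
  `multiplier_integral_inner_farField_nonpos`: `∫⟪v,c⟫dμ = M²μ(ℝ³) − S²`); the multiplier lives where `v ⟂ c` on average
  (`∫‖v − c‖²dμ = 2S²` was g3's).
* `tendsto_blowDown_laplacian_pairing_zero` : the Stokeslet law WITHOUT point force: `κ⋆²M²W·R⁻²∫⟪v − c', ΔΨ(R⁻¹x)⟫dx → 0` for
  every solenoidal `Ψ ∈ C_c^∞` and every constant `c'`.
* `tendsto_blowDown_vorticity_zero` : **the blow-down vorticity vanishes in `𝒟′` for every residue object**:
  `R⁻¹∫⟪curl v x, B(R⁻¹x)⟫dx → 0` for every `B ∈ C_c^∞(ℝ³;ℝ³)`.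

So every blow-down limit of `V_R = R(v − c)(R·)` (when it exists in `L²_loc`) is curl- and divergence-free; what remains of K1b is
the loss-of-compactness analysis of the record (`Lines/extremiser_liouville_k1b_jet.md` §6): jet = concentration/escape with window
energies `E₀ > 0`, flat = infinite slab energy.  WHAT THIS IS NOT: K1b is NOT proved; nothing here proves NS regularity. [folklore]
-/

noncomputable section

open Set Filter Topology MeasureTheory Metric Function
open scoped ENNReal NNReal Topology InnerProductSpace RealInnerProductSpace ContDiff Laplacian
open Literature.Analysis.FluidPDE Literature.Analysis

namespace Summit.NavierStokesRegularity.NavierStokesRegularity.Theorems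

-- the problem directory repeats the summit name (`NavierStokesRegularity/NavierStokesRegularity`)
set_option linter.dupNamespace false

namespace ExtremiserLiouville

open DepletionLadder.KStar DepletionLadder.KStar.HalfSpace

variable {v Ψ B : E3 → E3} {c : E3}

/-- **`∫⟪v, c⟫ dμ = 0` for every residue object** (axial frame): the barycentre vanishes. [folklore] -/
theorem multiplier_inner_farField_eq_zero (hv : ContDiff ℝ ∞ v) (hdiv : VectorCalculus.IsDivFree v) {M : ℝ}
    (hM : ∀ x, ‖v x‖ = M) (h1 : ∫⁻ x, ‖iteratedFDeriv ℝ 1 v x‖ₑ ^ 2 < ⊤) (h2 : ∫⁻ x, ‖iteratedFDeriv ℝ 2 v x‖ₑ ^ 2 < ⊤)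
    (μ : Measure E3) [IsFiniteMeasure μ]
    (hμ : ∀ ψ : E3 → E3, ContDiff ℝ ∞ ψ → HasCompactSupport ψ → VectorCalculus.IsDivFree ψ →
      Jst v * J1 v ψ - kStar ^ 2 * M ^ 2 * (Wpa v * A1 v ψ + Zen v * C1 v ψ) = ∫ x, ⟪v x, ψ x⟫_ℝ ∂μ)
    (hc0 : c 0 = 0) (hc1 : c 1 = 0) (hc2 : c 2 ≠ 0) (hcM : ‖c‖ = M) (hL6 : MemLp (fun x => v x - c) 6 volume) :
    ∫ x, ⟪v x, c⟫_ℝ ∂μ = 0 := by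
  have hvi : Integrable v μ :=
    (integrable_const M).mono' hv.continuous.aestronglyMeasurable (Eventually.of_forall fun x => (hM x).le)
  have e : (∫ x, ⟪v x, c⟫_ℝ ∂μ) = ⟪c, ∫ x, v x ∂μ⟫_ℝ := by
    rw [← integral_inner hvi]
    exact integral_congr_ae (Eventually.of_forall fun x => real_inner_comm _ _)
  rw [e, integral_barycentre_eq_zero_of_memLp hv hdiv hM h1 h2 μ hμ hc0 hc1 hc2 hcM hL6, inner_zero_right]

/-- **The multiplier has mass `μ(ℝ³) = S²/M²` EXACTLY, for every residue object** (axial frame; g3 had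
`S²/(2M²) ≤ μ(ℝ³) ≤ κ⋆²ZW = S²/M²`, g5 equality for the jet). [folklore] -/
theorem multiplier_mass_eq (hv : ContDiff ℝ ∞ v) (hdiv : VectorCalculus.IsDivFree v) {M B₀ : ℝ}
    (hM : ∀ x, ‖v x‖ = M) (hB : ∀ x, ‖fderiv ℝ v x‖ ≤ B₀)
    (h1 : ∫⁻ x, ‖iteratedFDeriv ℝ 1 v x‖ₑ ^ 2 < ⊤) (h2 : ∫⁻ x, ‖iteratedFDeriv ℝ 2 v x‖ₑ ^ 2 < ⊤)
    (hatt : |Jst v| = kStar * M * Real.sqrt (Zen v) * Real.sqrt (Wpa v))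
    (μ : Measure E3) [IsFiniteMeasure μ] (hmass : μ univ ≤ ENNReal.ofReal (kStar ^ 2 * Zen v * Wpa v))
    (hμ : ∀ ψ : E3 → E3, ContDiff ℝ ∞ ψ → HasCompactSupport ψ → VectorCalculus.IsDivFree ψ →
      Jst v * J1 v ψ - kStar ^ 2 * M ^ 2 * (Wpa v * A1 v ψ + Zen v * C1 v ψ) = ∫ x, ⟪v x, ψ x⟫_ℝ ∂μ)
    (hc0 : c 0 = 0) (hc1 : c 1 = 0) (hc2 : c 2 ≠ 0) (hcM : ‖c‖ = M) (hL6 : MemLp (fun x => v x - c) 6 volume) :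
    M ^ 2 * μ.real univ = Jst v ^ 2 := by
  have h := (multiplier_integral_inner_farField_nonpos hv hdiv hM hB h1 h2 hatt hL6 hmass hμ).1
  rw [multiplier_inner_farField_eq_zero hv hdiv hM h1 h2 μ hμ hc0 hc1 hc2 hcM hL6] at h
  linarith

/-- **The Stokeslet law without point force, for every residue object** (axial frame): for every solenoidal `Ψ ∈ C_c^∞` and
every constant `c'`, `κ⋆²M²W · R⁻²∫⟪v x − c', (ΔΨ)(R⁻¹x)⟫dx → 0`. [folklore] -/
theorem tendsto_blowDown_laplacian_pairing_zero (hv : ContDiff ℝ ∞ v) (hdiv : VectorCalculus.IsDivFree v) {M : ℝ}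
    (hM : ∀ x, ‖v x‖ = M) (h1 : ∫⁻ x, ‖iteratedFDeriv ℝ 1 v x‖ₑ ^ 2 < ⊤) (h2 : ∫⁻ x, ‖iteratedFDeriv ℝ 2 v x‖ₑ ^ 2 < ⊤)
    (μ : Measure E3) [IsFiniteMeasure μ]
    (hμ : ∀ ψ : E3 → E3, ContDiff ℝ ∞ ψ → HasCompactSupport ψ → VectorCalculus.IsDivFree ψ →
      Jst v * J1 v ψ - kStar ^ 2 * M ^ 2 * (Wpa v * A1 v ψ + Zen v * C1 v ψ) = ∫ x, ⟪v x, ψ x⟫_ℝ ∂μ)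
    (hc0 : c 0 = 0) (hc1 : c 1 = 0) (hc2 : c 2 ≠ 0) (hcM : ‖c‖ = M) (hL6 : MemLp (fun x => v x - c) 6 volume)
    (hΨ : ContDiff ℝ ∞ Ψ) (hΨc : HasCompactSupport Ψ) (hΨdiv : VectorCalculus.IsDivFree Ψ) (c' : E3) :
    Tendsto (fun R : ℝ => kStar ^ 2 * M ^ 2 * Wpa v * (R⁻¹ * R⁻¹ * ∫ x, ⟪v x - c', (Δ Ψ) (R⁻¹ • x)⟫_ℝ)) atTop (𝓝 0) := by
  have h := tendsto_blowDown_laplacian_pairing hv hM h1 h2 μ hμ hΨ hΨc hΨdiv c'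
  have hvi : Integrable v μ :=
    (integrable_const M).mono' hv.continuous.aestronglyMeasurable (Eventually.of_forall fun x => (hM x).le)
  have e : (∫ x, ⟪v x, Ψ 0⟫_ℝ ∂μ) = 0 := by
    have e' : (∫ x, ⟪v x, Ψ 0⟫_ℝ ∂μ) = ⟪Ψ 0, ∫ x, v x ∂μ⟫_ℝ := by
      rw [← integral_inner hvi]
      exact integral_congr_ae (Eventually.of_forall fun x => real_inner_comm _ _)
    rw [e', integral_barycentre_eq_zero_of_memLp hv hdiv hM h1 h2 μ hμ hc0 hc1 hc2 hcM hL6, inner_zero_right]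
  rwa [e] at h

/-- **The blow-down vorticity vanishes in `𝒟′` for EVERY residue object** (axial frame, flat or jet): `v` smooth, divergence free,
`‖v‖ ≡ M`, `D¹v, D²v ∈ L²`, `M√Z√W > 0`, `μ` finite with the multiplier identity, `c = (0,0,c₂)`, `‖c‖ = M`, `v − c ∈ L⁶` ⟹
`R⁻¹∫⟪curl v x, B(R⁻¹x)⟫dx → 0` for every `B ∈ C_c^∞(ℝ³;ℝ³)`. [folklore] -/
theorem tendsto_blowDown_vorticity_zero (hv : ContDiff ℝ ∞ v) (hdiv : VectorCalculus.IsDivFree v) {M : ℝ}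
    (hM : ∀ x, ‖v x‖ = M) (h1 : ∫⁻ x, ‖iteratedFDeriv ℝ 1 v x‖ₑ ^ 2 < ⊤) (h2 : ∫⁻ x, ‖iteratedFDeriv ℝ 2 v x‖ₑ ^ 2 < ⊤)
    (hpos : 0 < M * Real.sqrt (Zen v) * Real.sqrt (Wpa v))
    (μ : Measure E3) [IsFiniteMeasure μ]
    (hμ : ∀ ψ : E3 → E3, ContDiff ℝ ∞ ψ → HasCompactSupport ψ → VectorCalculus.IsDivFree ψ →
      Jst v * J1 v ψ - kStar ^ 2 * M ^ 2 * (Wpa v * A1 v ψ + Zen v * C1 v ψ) = ∫ x, ⟪v x, ψ x⟫_ℝ ∂μ)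
    (hc0 : c 0 = 0) (hc1 : c 1 = 0) (hc2 : c 2 ≠ 0) (hcM : ‖c‖ = M) (hL6 : MemLp (fun x => v x - c) 6 volume)
    (hB : ContDiff ℝ ∞ B) (hBc : HasCompactSupport B) :
    Tendsto (fun R : ℝ => R⁻¹ * ∫ x, ⟪curl v x, B (R⁻¹ • x)⟫_ℝ) atTop (𝓝 0) := by
  have hM0 : 0 ≤ M := (norm_nonneg _).trans (hM 0).le
  have hMpos : 0 < M := by
    rcases hM0.lt_or_eq with h | h
    · exact h
    · rw [← h, zero_mul, zero_mul] at hpos; exact absurd hpos (lt_irrefl 0)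
  have hW : 0 < Wpa v := by
    have hs : 0 < Real.sqrt (Wpa v) := by
      by_contra h
      have h0 : Real.sqrt (Wpa v) = 0 := le_antisymm (not_lt.1 h) (Real.sqrt_nonneg _)
      rw [h0, mul_zero] at hpos; exact lt_irrefl 0 hpos
    exact Real.sqrt_pos.1 hs
  exact tendsto_blowDown_vorticity_of_barycentre_eq_zero hv hM hMpos hW h1 h2 μ hμ
    (integral_barycentre_eq_zero_of_memLp hv hdiv hM h1 h2 μ hμ hc0 hc1 hc2 hcM hL6) hB hBc

end ExtremiserLiouville

end Summit.NavierStokesRegularity.NavierStokesRegularity.Theorems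

end
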